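import Summits.QuantumFields.YangMills.Theorems.LuscherReductionTwistedTraceScalingHarmonicStepMode
import Summits.QuantumFields.YangMills.Theorems.LuscherReductionTwistedTraceScalingHarmonicStepFrame
import Summits.QuantumFields.YangMills.Theorems.LuscherReductionTwistedTraceScalingSpectralWeight
import Mathlib.MeasureTheory.Measure.Haar.InnerProductSpace
import HarnessLib

/-!
# THE COVARIANT HARMONIC STEP IDENTITY: the model step integral over the whole link space in closed form
# (covariant programme, brick c4(iii)-integral)

Cell `ym-fleet`, crux `TwistedTraceScaling` (stmt-QuantumFields-20203), line «twolattice», stub S-BASE, lane B = COARSE-LOWER(L₁)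
(design note `pub/ym-fleet/ym-20203-coarse-s1/LOWER-BLUEPRINT.md` §5–§6, c4(iii)).  HONEST FRAMING: an exact finite-dimensional Gaussian integral;
a stub of a child of the CONDITIONAL reduction route (femto rung R2b1); not a gap, not Clay.

For finite-dimensional real inner-product spaces `V` (steps), `W` (curvatures), a linear `D : V → W`, an orthonormal eigenframe `(eᵢ, λᵢ)` of
`D†D`, `t ≥ 0`, `b > 0`, weights `ĉᵢ ≥ 0` and a curvature `F : W` (`φᵢ := ⟨D eᵢ, F⟩`):

* ★★ `integral_harmonicStep_eq` —
  `∫_V e^{−b‖w‖²} e^{−t‖F + Dw‖²} e^{−Σᵢ ĉᵢ⟨Deᵢ, F + Dw⟩²} dw = e^{−t‖F‖²} · Πᵢ √(π/(tλᵢ + b + ĉᵢλᵢ²)) · e^{2tφᵢ²/λᵢ} · e^{−κᵢ(φᵢ/λᵢ)²} · e^{−ĉᵢφᵢ²}`,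
  `κᵢ = Harm.stepGain λᵢ t b ĉᵢ` (zero modes: `λᵢ = 0 ⇒ φᵢ = 0`, factor `√(π/b)`): frame transport `V ≃ (ι → ℝ)` (volume preserving) +
  `Harm.stepIntegrand_eq_prod` + `Harm.integral_stepModes_pi_of_nonneg`;
* `integral_harmonicStep_eq'` — the same with the `F`-potential in front: `e^{−t‖F‖²}·∫… = e^{−2t‖F‖²}·Π…`, i.e. in the Riccati case the weight
  `e^{−Σĉᵢφᵢ²}` is reproduced with the normalisation `Πᵢ√(π/s'ᵢ)` times the DEFECT factor `e^{−2t(‖F‖² − Σᵢφᵢ²/λᵢ)} ≤ 1`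
  (`Harm.sum_sq_div_le_norm_sq`; `= 1` iff `F ∈ range D`);
* ★ `integral_harmonicStep_weightForm` — on `V = EuclideanSpace ℝ n` with the CANONICAL weight `q_D = ⟨D†·, g(D†D)D†·⟩` of `…SpectralWeight`:
  `∫ e^{−b‖w‖²} e^{−t‖F+Dw‖²} e^{−q_D(F+Dw)} dw` in closed form over Mathlib's Gram eigenframe, `ĉᵢ = g(λᵢ)`.

## References
* A. Wipf, *Statistical Approach to Quantum Field Theory*, LNP 992 (2021), §8.5.1–§8.5.2. [Wipf2021]
* M. Lüscher, Nucl. Phys. B219 (1983) 233, §3. [Luscher1983]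
-/

noncomputable section

open MeasureTheory Real
open scoped RealInnerProductSpace

namespace Summit.QuantumFields.YangMills.Theorems.FemtoTransferGap.TwoLattice.Harm

variable {V W : Type*} [NormedAddCommGroup V] [InnerProductSpace ℝ V] [FiniteDimensional ℝ V] [MeasurableSpace V] [BorelSpace V]
  [NormedAddCommGroup W] [InnerProductSpace ℝ W] [FiniteDimensional ℝ W]
variable {ι : Type*} [Fintype ι]

/-! ## §1 Frame transport `V ≃ (ι → ℝ)` -/

/-- The coordinate map of an orthonormal frame as a volume-preserving measurable equivalence `V ≃ᵐ (ι → ℝ)` with `Ψ x i = ⟨eᵢ, x⟩`.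
[folklore] -/
theorem exists_frameCoord (e : OrthonormalBasis ι ℝ V) :
    ∃ Ψ : V ≃ᵐ (ι → ℝ), MeasurePreserving Ψ volume volume ∧ ∀ x i, Ψ x i = ⟪e i, x⟫ := by
  refine ⟨e.measurableEquiv.trans (MeasurableEquiv.toLp 2 (ι → ℝ)).symm,
    (e.measurePreserving_measurableEquiv).trans (EuclideanSpace.volume_preserving_symm_measurableEquiv_toLp ι), fun x i => ?_⟩
  simp only [MeasurableEquiv.trans_apply]
  show (MeasurableEquiv.toLp 2 (ι → ℝ)).symm (e.repr x) i = ⟪e i, x⟫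
  rw [← e.repr_apply_apply]
  rfl

/-- Integration in frame coordinates: `∫_V G(⟨e·, w⟩) dw = ∫_{ι → ℝ} G(x) dx`. [folklore] -/
theorem integral_comp_frameCoord (e : OrthonormalBasis ι ℝ V) (G : (ι → ℝ) → ℝ) :
    ∫ w : V, G (fun i => ⟪e i, w⟫) = ∫ x : ι → ℝ, G x := by
  obtain ⟨Ψ, hΨ, hΨe⟩ := exists_frameCoord e
  have h : ∀ w : V, (fun i => ⟪e i, w⟫) = Ψ w := fun w => funext fun i => (hΨe w i).symm
  simp_rw [h]
  exact hΨ.integral_comp Ψ.measurableEmbedding G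

/-! ## §2 The identity -/

/-- ★★ **THE COVARIANT HARMONIC STEP IDENTITY.**  For `D : V →ₗ W`, an orthonormal eigenframe `D†D eᵢ = λᵢ eᵢ`, `t ≥ 0`, `b > 0`, `ĉᵢ ≥ 0`:
`∫_V e^{−b‖w‖²} e^{−t‖F + Dw‖²} e^{−Σᵢ ĉᵢ⟨Deᵢ, F+Dw⟩²} dw = e^{−t‖F‖²} Πᵢ √(π/(tλᵢ+b+ĉᵢλᵢ²)) e^{2tφᵢ²/λᵢ} e^{−κᵢ(φᵢ/λᵢ)²} e^{−ĉᵢφᵢ²}`,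
`φᵢ = ⟨Deᵢ, F⟩`, `κᵢ = stepGain λᵢ t b ĉᵢ`. [cite: Wipf2021, §8.5.2 (8.64)–(8.67)] -/
theorem integral_harmonicStep_eq {D : V →ₗ[ℝ] W} {e : OrthonormalBasis ι ℝ V} {lam : ι → ℝ}
    (hD : ∀ i, D.adjoint (D (e i)) = lam i • e i) {t b : ℝ} (ht : 0 ≤ t) (hb : 0 < b) {ĉ : ι → ℝ} (hĉ : ∀ i, 0 ≤ ĉ i) (F : W) :
    ∫ w : V, Real.exp (-(b * ‖w‖ ^ 2)) * Real.exp (-(t * ‖F + D w‖ ^ 2)) * Real.exp (-(∑ i, ĉ i * ⟪D (e i), F + D w⟫ ^ 2)) =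
      Real.exp (-(t * ‖F‖ ^ 2)) *
        ∏ i, Real.sqrt (π / (t * lam i + b + ĉ i * lam i ^ 2)) * Real.exp (2 * t * ⟪D (e i), F⟫ ^ 2 / lam i) *
          Real.exp (-(stepGain (lam i) t b (ĉ i) * (⟪D (e i), F⟫ / lam i) ^ 2)) * Real.exp (-(ĉ i * ⟪D (e i), F⟫ ^ 2)) := by
  simp_rw [stepIntegrand_eq_prod hD t b ĉ F]
  rw [integral_const_mul]
  congr 1
  rw [integral_comp_frameCoord e (fun x : ι → ℝ => ∏ i, Real.exp (-(b * x i ^ 2)) *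
    Real.exp (-(t * (2 * ⟪D (e i), F⟫ * x i + lam i * x i ^ 2))) * Real.exp (-(ĉ i * (⟪D (e i), F⟫ + lam i * x i) ^ 2)))]
  exact integral_stepModes_pi_of_nonneg (eigenvalue_nonneg hD) ht hb hĉ fun i hi => inner_map_eq_zero_of_eigenvalue hD hi F

/-- The identity with the `F`-potential in front (the RATIO form used by the Schur / ground-state-transform doors):
`e^{−t‖F‖²} ∫ … = e^{−2t‖F‖²} · Πᵢ …`. [cite: Wipf2021, §8.5.2 (8.64)–(8.67)] -/
theorem integral_harmonicStep_eq' {D : V →ₗ[ℝ] W} {e : OrthonormalBasis ι ℝ V} {lam : ι → ℝ}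
    (hD : ∀ i, D.adjoint (D (e i)) = lam i • e i) {t b : ℝ} (ht : 0 ≤ t) (hb : 0 < b) {ĉ : ι → ℝ} (hĉ : ∀ i, 0 ≤ ĉ i) (F : W) :
    Real.exp (-(t * ‖F‖ ^ 2)) *
        ∫ w : V, Real.exp (-(b * ‖w‖ ^ 2)) * Real.exp (-(t * ‖F + D w‖ ^ 2)) * Real.exp (-(∑ i, ĉ i * ⟪D (e i), F + D w⟫ ^ 2)) =
      Real.exp (-(2 * t * ‖F‖ ^ 2)) *
        ∏ i, Real.sqrt (π / (t * lam i + b + ĉ i * lam i ^ 2)) * Real.exp (2 * t * ⟪D (e i), F⟫ ^ 2 / lam i) *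
          Real.exp (-(stepGain (lam i) t b (ĉ i) * (⟪D (e i), F⟫ / lam i) ^ 2)) * Real.exp (-(ĉ i * ⟪D (e i), F⟫ ^ 2)) := by
  rw [integral_harmonicStep_eq hD ht hb hĉ F, ← mul_assoc, ← Real.exp_add]
  congr 2
  ring

/-- ★ **RICCATI WEIGHTS REPRODUCE THEMSELVES UP TO THE DEFECT FACTOR**: if every mode carries either its Riccati weight
(`(ĉᵢλᵢ²)² = (tλᵢ)² + 2tλᵢb`) — then `e^{−t‖F‖²}∫… = Πᵢ√(π/s'ᵢ) · e^{−2t(‖F‖² − Σᵢφᵢ²/λᵢ)} · e^{−Σᵢĉᵢφᵢ²}`, where the defect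
`‖F‖² − Σᵢφᵢ²/λᵢ = dist(F, range D)² ≥ 0` (`Harm.sum_sq_div_le_norm_sq`). [cite: Wipf2021, §8.5.2 (8.64)–(8.67)] -/
theorem integral_harmonicStep_riccati {D : V →ₗ[ℝ] W} {e : OrthonormalBasis ι ℝ V} {lam : ι → ℝ}
    (hD : ∀ i, D.adjoint (D (e i)) = lam i • e i) {t b : ℝ} (ht : 0 ≤ t) (hb : 0 < b) {ĉ : ι → ℝ} (hĉ : ∀ i, 0 ≤ ĉ i)
    (hric : ∀ i, (ĉ i * lam i ^ 2) ^ 2 = (t * lam i) ^ 2 + 2 * (t * lam i) * b) (F : W) :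
    Real.exp (-(t * ‖F‖ ^ 2)) *
        ∫ w : V, Real.exp (-(b * ‖w‖ ^ 2)) * Real.exp (-(t * ‖F + D w‖ ^ 2)) * Real.exp (-(∑ i, ĉ i * ⟪D (e i), F + D w⟫ ^ 2)) =
      (∏ i, Real.sqrt (π / (t * lam i + b + ĉ i * lam i ^ 2))) *
        Real.exp (-(2 * t * (‖F‖ ^ 2 - ∑ i, ⟪D (e i), F⟫ ^ 2 / lam i))) * Real.exp (-(∑ i, ĉ i * ⟪D (e i), F⟫ ^ 2)) := by
  rw [integral_harmonicStep_eq' hD ht hb hĉ F]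
  simp only [fun i => stepGain_eq_zero_of_riccati (hric i), zero_mul, neg_zero, Real.exp_zero, mul_one]
  rw [Finset.prod_mul_distrib, Finset.prod_mul_distrib, ← Real.exp_sum, ← Real.exp_sum]
  have h1 : Real.exp (-(2 * t * ‖F‖ ^ 2)) * Real.exp (∑ i, 2 * t * ⟪D (e i), F⟫ ^ 2 / lam i) =
      Real.exp (-(2 * t * (‖F‖ ^ 2 - ∑ i, ⟪D (e i), F⟫ ^ 2 / lam i))) := by
    rw [← Real.exp_add]
    congr 1
    rw [mul_sub, Finset.mul_sum]
    have : ∀ i, 2 * t * (⟪D (e i), F⟫ ^ 2 / lam i) = 2 * t * ⟪D (e i), F⟫ ^ 2 / lam i := fun i => (mul_div_assoc _ _ _).symm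
    simp only [this]
    ring
  have h2 : Real.exp (∑ i, -(ĉ i * ⟪D (e i), F⟫ ^ 2)) = Real.exp (-(∑ i, ĉ i * ⟪D (e i), F⟫ ^ 2)) := by
    rw [Finset.sum_neg_distrib]
  rw [h2, ← h1]
  ring

omit [MeasurableSpace V] [BorelSpace V] in
/-- The defect factor is at most one: `e^{−2t(‖F‖² − Σᵢφᵢ²/λᵢ)} ≤ 1` (`t ≥ 0`). [cite: HornJohnson2013, Thm 7.3.2] -/
theorem defectFactor_le_one {D : V →ₗ[ℝ] W} {e : OrthonormalBasis ι ℝ V} {lam : ι → ℝ}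
    (hD : ∀ i, D.adjoint (D (e i)) = lam i • e i) {t : ℝ} (ht : 0 ≤ t) (F : W) :
    Real.exp (-(2 * t * (‖F‖ ^ 2 - ∑ i, ⟪D (e i), F⟫ ^ 2 / lam i))) ≤ 1 := by
  rw [Real.exp_le_one_iff, neg_nonpos]
  exact mul_nonneg (by positivity) (sub_nonneg.mpr (sum_sq_div_le_norm_sq hD F))

omit [MeasurableSpace V] [BorelSpace V] in
/-- … and bounded below through ANY trial preimage `x`: `e^{−2t‖F − Dx‖²} ≤ e^{−2t(‖F‖² − Σᵢφᵢ²/λᵢ)}`. [cite: HornJohnson2013, Thm 7.3.2] -/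
theorem exp_neg_dist_le_defectFactor {D : V →ₗ[ℝ] W} {e : OrthonormalBasis ι ℝ V} {lam : ι → ℝ}
    (hD : ∀ i, D.adjoint (D (e i)) = lam i • e i) {t : ℝ} (ht : 0 ≤ t) (F : W) (x : V) :
    Real.exp (-(2 * t * ‖F - D x‖ ^ 2)) ≤ Real.exp (-(2 * t * (‖F‖ ^ 2 - ∑ i, ⟪D (e i), F⟫ ^ 2 / lam i))) := by
  rw [Real.exp_le_exp, neg_le_neg_iff]
  exact mul_le_mul_of_nonneg_left (norm_sq_sub_sum_le hD F x) (by positivity)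

/-! ## §3 The canonical weight of `…SpectralWeight` -/

section Canonical

variable {n : Type*} [Fintype n] [DecidableEq n]

/-- ★ **THE IDENTITY FOR THE CANONICAL TRIAL EXPONENT** `q_D(G) = ⟨D†G, g(D†D) D†G⟩` on `V = EuclideanSpace ℝ n`: with Mathlib's Gram eigenframe
`(eᵢ, λᵢ)` of `D` and `ĉᵢ = g(λᵢ) ≥ 0`,
`∫ e^{−b‖w‖²} e^{−t‖F+Dw‖²} e^{−q_D(F+Dw)} dw = e^{−t‖F‖²} Πᵢ √(π/(tλᵢ+b+g(λᵢ)λᵢ²)) e^{2tφᵢ²/λᵢ} e^{−κᵢ(φᵢ/λᵢ)²} e^{−g(λᵢ)φᵢ²}`.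
[cite: Wipf2021, §8.5.2 (8.64)–(8.67)] [cite: Luscher1983, §3] -/
theorem integral_harmonicStep_weightForm (D : EuclideanSpace ℝ n →ₗ[ℝ] W) {g : ℝ → ℝ} (hg : ∀ s, 0 ≤ g s) {t b : ℝ} (ht : 0 ≤ t)
    (hb : 0 < b) (F : W) :
    ∫ w : EuclideanSpace ℝ n, Real.exp (-(b * ‖w‖ ^ 2)) * Real.exp (-(t * ‖F + D w‖ ^ 2)) * Real.exp (-(weightForm g D (F + D w))) =
      Real.exp (-(t * ‖F‖ ^ 2)) *
        ∏ i, Real.sqrt (π / (t * (gramMatrix_isHermitian D).eigenvalues i + b +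
            g ((gramMatrix_isHermitian D).eigenvalues i) * (gramMatrix_isHermitian D).eigenvalues i ^ 2)) *
          Real.exp (2 * t * ⟪D ((gramMatrix_isHermitian D).eigenvectorBasis i), F⟫ ^ 2 / (gramMatrix_isHermitian D).eigenvalues i) *
          Real.exp (-(stepGain ((gramMatrix_isHermitian D).eigenvalues i) t b (g ((gramMatrix_isHermitian D).eigenvalues i)) *
            (⟪D ((gramMatrix_isHermitian D).eigenvectorBasis i), F⟫ / (gramMatrix_isHermitian D).eigenvalues i) ^ 2)) *
          Real.exp (-(g ((gramMatrix_isHermitian D).eigenvalues i) * ⟪D ((gramMatrix_isHermitian D).eigenvectorBasis i), F⟫ ^ 2)) := by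
  have hD := gram_frame D
  simp_rw [weightForm_eq_sum g D hD]
  exact integral_harmonicStep_eq hD ht hb (fun i => hg _) F

end Canonical

end Summit.QuantumFields.YangMills.Theorems.FemtoTransferGap.TwoLattice.Harm

end
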